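import Literature.AlgebraicGeometry.HodgeTheory.ComplexTorusIntegralHodgeClassesCorrespondenceFunctoriality
import HarnessLib

/-!
# Push-forwards of correspondences and degenerate compositions on integral Hodge classes of complex tori

Two consequences of the projection formula (g27-#2) and the product formula (g27-#7) for correspondences acting on
`Hdg•(−, ℤ)` (action `Z(β) = p_{2*}(Z · p₁^* β)`, composition `β ∘ α = p₁₃*(p₁₂^*α · p₂₃^*β)` on `X × (Y × Z)` as in g27-#5):

* **`integralHodgeClassesCorr_prodMap_pushforward_act`** — Birkenhake–Lange (6.8): `((f₁ × f₂)_* Z′)(β) = f₂_*(Z′(f₁^* β))` for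
  homomorphisms `fᵢ : Xᵢ′ → Xᵢ` and `Z′ ∈ Hdg(X₁′ × X₂′)` (projection formula for `f₁ × f₂` and `p₁ (f₁ × f₂) = f₁ p₁′`,
  `p₂ (f₁ × f₂) = f₂ p₂′`);
* **`integralHodgeClassesCorrComp_integralHodgeClassesCross_left`** — Fulton's Example 16.1.2 (a): `β ∘ (γ ⊠ δ) = γ ⊠ β_*(δ)` for
  `γ ∈ Hdg(X)`, `δ ∈ Hdg(Y)`, `β ∈ Hdg(Y × Z)` (`p₁₂^*(γ ⊠ δ) · p₂₃^*β = γ ⊠ (β · p_Y^*δ)` on `X × (Y × Z)`, `p₁₃ = 1_X × p_Z`, and the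
  product formula `(1_X × p_Z)_*(γ ⊠ w) = γ ⊠ p_{Z*} w`);
* `liftHom_fstHom_sndHom_comp` — `(p₁, p₂ ≫ g) = 1 × g`.

Everything is proved; no named fact is introduced (D-0026).

## References

* [Lange2023AbelianVarietiesComplex] H. Lange, *Abelian Varieties over the Complex Numbers*, Springer (2023), §6.2.2 Lemma 6.2.8,
  Prop. 6.2.10 and (6.8) (p0304 L1–L36), Thm. 6.2.4 (projection formula, p0302).
* [Fulton1998] W. Fulton, *Intersection Theory*, 2nd ed., Springer (1998), §16.1 Def. 16.1.1, Example 16.1.2 (a) (p0296 L8–L12),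
  §1.10 Prop. 1.10 (b) (p0035).
-/

noncomputable section

open CategoryTheory Function

namespace Literature.AlgebraicGeometry.HodgeTheory

open Literature.AlgebraicGeometry.Motives Literature.AlgebraicGeometry.Motives.HodgeStructure
open Literature.Geometry.Kaehler Literature.Geometry.Kaehler.ComplexTorus

namespace ComplexTorusCat

/-- `(p₁, p₂ ≫ g) = 1_X × g : X × Y → X × Y′`. [cite: Lange2023AbelianVarietiesComplex, §1.1.2 (p0021 L5)] -/
theorem liftHom_fstHom_sndHom_comp (X : ComplexTorusCat) {Y Y' : ComplexTorusCat} (g : Y ⟶ Y') :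
    liftHom (fstHom X Y) (sndHom X Y ≫ g) = prodMap (𝟙 X) g := by
  rw [prodMap_eq_liftHom, Category.comp_id]

/-! ## §1 Birkenhake–Lange (6.8): `((f₁ × f₂)_* Z′)(β) = f₂_*(Z′(f₁^* β))` -/

section PushforwardAction

variable {X₁ X₂ X₁' X₂' : ComplexTorusCat} (f₁ : X₁' ⟶ X₁) (f₂ : X₂' ⟶ X₂) {n₂ n₂' n₁₂ n₁₂' g₂ g₂' g₁₂ g₁₂' : ℕ}
  (e₂ : Fin n₂ ≃ X₂.toIsog.ι) (e₂' : Fin n₂' ≃ X₂'.toIsog.ι) (e₁₂ : Fin n₁₂ ≃ (prodObj X₁ X₂).toIsog.ι) (e₁₂' : Fin n₁₂' ≃ (prodObj X₁' X₂').toIsog.ι)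
  (hg₂ : g₂ + g₂ = n₂) (hg₂' : g₂' + g₂' = n₂') (hg₁₂ : g₁₂ + g₁₂ = n₁₂) (hg₁₂' : g₁₂' + g₁₂' = n₁₂')
  {a a' p q q' r c lP lS lS' lF : ℕ} (hq : a' + p = q) (hq' : a + p = q')
  (hP : lP + 2 * a = n₁₂') (hP' : lP + 2 * a' = n₁₂) (hS : lS + 2 * q = n₁₂) (hS' : lS + 2 * r = n₂)
  (hT : lS' + 2 * q' = n₁₂') (hT' : lS' + 2 * c = n₂') (hF : lF + 2 * c = n₂') (hF' : lF + 2 * r = n₂)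

include hP hP' in
/-- **BIRKENHAKE–LANGE (6.8) ON INTEGRAL HODGE CLASSES: `((f₁ × f₂)_* Z′)(β) = f₂_*(Z′(f₁^* β))`** for homomorphisms `f₁ : X₁′ → X₁`, `f₂ : X₂′ → X₂`
of complex tori, `Z′ ∈ Hdgᵃ(X₁′ × X₂′, ℤ)`, `β ∈ Hdgᵖ(X₁, ℤ)` (`Z(β) = p_{2*}(Z · p₁^*β)`): projection formula for `f₁ × f₂` ("`(f₁ × f₂)_* Z′ · p₁^*β =
(f₁ × f₂)_*(Z′ · (f₁ × f₂)^* p₁^* β)`"), `p₁ ∘ (f₁ × f₂) = f₁ ∘ p₁′` and `p₂ ∘ (f₁ × f₂) = f₂ ∘ p₂′`. (Lange derives it from Prop. 6.2.10 (b) and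
Lemma 6.2.8; the direct computation needs neither.) [cite: Lange2023AbelianVarietiesComplex, §6.2.2 (6.8) (p0304 L33–L36) and Thm. 6.2.4 (p0302 L17–L19)]
[cite: Fulton1998, §16.1 Prop. 16.1.1 (c) proof pattern (p0294 L21–L26)] -/
theorem integralHodgeClassesCorr_prodMap_pushforward_act (Z' : integralHodgeClasses (prodObj X₁' X₂').toIsog.Φ a) (β : integralHodgeClasses X₁.toIsog.Φ p) :
    integralHodgeClassesPushforward q r (sndHom X₁ X₂) e₁₂ e₂ hS hg₁₂ hS' hg₂
        (integralHodgeClassesCup (prodObj X₁ X₂).toIsog.Φ hq (integralHodgeClassesPushforward a a' (prodMap f₁ f₂) e₁₂' e₁₂ hP hg₁₂' hP' hg₁₂ Z')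
          (integralHodgeClassesPullbackHom (fstHom X₁ X₂) p β)) =
      integralHodgeClassesPushforward c r f₂ e₂' e₂ hF hg₂' hF' hg₂
        (integralHodgeClassesPushforward q' c (sndHom X₁' X₂') e₁₂' e₂' hT hg₁₂' hT' hg₂'
          (integralHodgeClassesCup (prodObj X₁' X₂').toIsog.Φ hq' Z'
            (integralHodgeClassesPullbackHom (fstHom X₁' X₂') p (integralHodgeClassesPullbackHom f₁ p β)))) := by
  obtain rfl : lS = lS' := by omega
  obtain rfl : lS = lF := by omega
  rw [← integralHodgeClassesPushforward_cup_pullbackHom (prodMap f₁ f₂) e₁₂' e₁₂ hg₁₂' hg₁₂ hq' hq hP hP' hT hS, ← integralHodgeClassesPullbackHom_comp,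
    prodMap_fstHom, integralHodgeClassesPullbackHom_comp, ← integralHodgeClassesPushforward_comp, prodMap_sndHom, ← integralHodgeClassesPushforward_comp]

end PushforwardAction

/-! ## §2 Fulton's Example 16.1.2 (a): `β ∘ (γ ⊠ δ) = γ ⊠ β_*(δ)` -/

section DegenerateComposition

variable {X Y Z : ComplexTorusCat} {gX gZ gYZ gXZ gT : ℕ} (hgg : gX + gYZ = gT) (hgg' : gX + gZ = gXZ) (eX : Fin (2 * gX) ≃ X.toIsog.ι)
  (eZ : Fin (2 * gZ) ≃ Z.toIsog.ι) (eYZ : Fin (2 * gYZ) ≃ (prodObj Y Z).toIsog.ι) (eXZ : Fin (2 * gXZ) ≃ (prodObj X Z).toIsog.ι)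
  (eT : Fin (2 * gT) ≃ (prodObj X (prodObj Y Z)).toIsog.ι)
  (hgX : gX + gX = 2 * gX) (hgZ : gZ + gZ = 2 * gZ) (hgYZ : gYZ + gYZ = 2 * gYZ) (hgXZ : gXZ + gXZ = 2 * gXZ) (hgT : gT + gT = 2 * gT)
  {p q r b c m t e' lX L l₃ : ℕ} (hpq : p + q = r) (hrb : r + b = c) (hbq : b + q = t) (hpe : p + e' = m)
  (hlX : lX + 2 * p = 2 * gX) (k : L + 2 * t = 2 * gYZ) (k' : L + 2 * e' = 2 * gZ) (h3 : l₃ + 2 * c = 2 * gT) (h3' : l₃ + 2 * m = 2 * gXZ)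

set_option maxHeartbeats 400000 in
include hgg hgg' eX hgX hlX in
/-- **FULTON'S EXAMPLE 16.1.2 (a) ON INTEGRAL HODGE CLASSES: `β ∘ (γ ⊠ δ) = γ ⊠ β_*(δ)`** for `γ ∈ Hdgᵖ(X, ℤ)`, `δ ∈ Hdg^q(Y, ℤ)` and a correspondence
`β ∈ Hdgᵇ(Y × Z, ℤ)` (`β_*(δ) = p_{Z*}(β · p_Y^*δ)`; `β ∘ α = p₁₃*(p₁₂^*α · p₂₃^*β)` on `X × (Y × Z)`): `p₁₂^*(γ × δ) · p₂₃^*β = γ × (β · p_Y^*δ)` on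
`X × (Y × Z)`, `p₁₃ = 1_X × p_Z`, and the product formula `(1_X × p_Z)_*(γ × w) = γ × p_{Z*}(w)` (g27-#7).
[cite: Fulton1998, §16.1 Example 16.1.2 (a) (p0296 L8–L10: "β ∘ (γ × δ) = γ × β_*(δ)") and §1.10 Prop. 1.10 (b) (p0035)]
[cite: Lange2023AbelianVarietiesComplex, §6.2.2 (p0303 L19–L29)] -/
theorem integralHodgeClassesCorrComp_integralHodgeClassesCross_left (γ : integralHodgeClasses X.toIsog.Φ p) (δ : integralHodgeClasses Y.toIsog.Φ q)
    (β : integralHodgeClasses (prodObj Y Z).toIsog.Φ b) :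
    integralHodgeClassesPushforward c m (liftHom (fstHom X (prodObj Y Z)) (sndHom X (prodObj Y Z) ≫ sndHom Y Z)) eT eXZ h3 hgT h3' hgXZ
        (integralHodgeClassesCup (prodObj X (prodObj Y Z)).toIsog.Φ hrb
          (integralHodgeClassesPullbackHom (liftHom (fstHom X (prodObj Y Z)) (sndHom X (prodObj Y Z) ≫ fstHom Y Z)) r
            (integralHodgeClassesCross X Y hpq γ δ))
          (integralHodgeClassesPullbackHom (sndHom X (prodObj Y Z)) b β)) =
      integralHodgeClassesCross X Z hpe γ
        (integralHodgeClassesPushforward t e' (sndHom Y Z) eYZ eZ k hgYZ k' hgZ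
          (integralHodgeClassesCup (prodObj Y Z).toIsog.Φ hbq β (integralHodgeClassesPullbackHom (fstHom Y Z) q δ))) := by
  obtain rfl : l₃ = lX + L := by omega
  rw [integralHodgeClassesCross_apply X Y hpq, integralHodgeClassesPullbackHom_cup, ← integralHodgeClassesPullbackHom_comp, ← integralHodgeClassesPullbackHom_comp,
    liftHom_fstHom, liftHom_sndHom, integralHodgeClassesPullbackHom_comp,
    integralHodgeClassesCup_assoc _ hpq hrb (show q + b = t by omega) (show p + t = c by omega), ← integralHodgeClassesPullbackHom_cup,
    integralHodgeClassesCup_comm _ hbq (show q + b = t by omega), ← integralHodgeClassesCross_apply X (prodObj Y Z) (show p + t = c by omega),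
    liftHom_fstHom_sndHom_comp,
    integralHodgeClassesPushforward_eq_of_enum' c m (prodMap (𝟙 X) (sndHom Y Z)) (by omega : 2 * gT = 2 * gX + 2 * gYZ) (by omega : 2 * gXZ = 2 * gX + 2 * gZ)
      eT (sumEnum eX eYZ) eXZ (sumEnum eX eZ) h3 hgT h3' hgXZ (show (lX + L) + 2 * c = 2 * gX + 2 * gYZ by omega)
      (show gT + gT = 2 * gX + 2 * gYZ by omega) (show (lX + L) + 2 * m = 2 * gX + 2 * gZ by omega) (show gXZ + gXZ = 2 * gX + 2 * gZ by omega),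
    integralHodgeClassesPushforward_prodMap_integralHodgeClassesCross (𝟙 X) (sndHom Y Z) eX eX eYZ eZ hlX hgX hlX hgX k hgYZ k' hgZ
      (show p + t = c by omega) hpe,
    integralHodgeClassesPushforward_id]

end DegenerateComposition

end ComplexTorusCat

end Literature.AlgebraicGeometry.HodgeTheory
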